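import Mathlib
import HarnessLib

/-!
# LatticeQCDFlow / Scaling — the pseudo-marginal cost optimum `N_pf* = √(C·c_q/c_s)`

HONEST FRAMING: exact (Metropolis-corrected) sampling algorithms for lattice gauge theory;
figures of merit are autocorrelation/cost numbers at stated couplings and volumes; no
continuum-physics claim.

Venture `LatticeQCDFlow` (cell pub-lqcd), topic `Scaling`; landed by FANOUT row 38 (r2-scope) as the
Lean face of the "OURS" formula of HOME/R2-SCOPE.md §4 cost class C-PM ("pseudo-marginal =
N_pf(N_h+1) solves/proposal, optimum N_pf* = √(C·c_q/c_s) (OURS from the printed ESS(N_pf) law)").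
NEW WORK of the cell (elementary real algebra), not a published result.  The printed input is the
N_pf law of Abbott et al., PRD 106 (2022) 074506 §III.E, `ESS(N_pf) = ESS(∞)/(1 + C/N_pf)` — in the
tree as `Literature.Probability.ImportanceSampling.ess_npf_law` with the explicit population
constant `npfConstant` (`PseudofermionESS.lean`; not imported here, only its conclusion is used as
the shape of the cost function).

Cost model.  A proposal costs `c_q` (gauge flow + bookkeeping) plus `c_s` per pseudofermion draw
(`(N_h + 1)` solves each, absorbed in `c_s`), i.e. `c_q + N·c_s` for `N = N_pf` draws; the number of
proposals per effectively independent configuration is `1/ESS(N) = (1 + C/N)/ESS(∞)`.  Up to the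
`N`-independent factor `1/ESS(∞)` the cost per effectively independent configuration is

  `pmCost c_q c_s C N = (c_q + N·c_s)·(1 + C/N)`,  `N > 0` real.

Results (all proved):
* `pmCost_expand` — `pmCost = c_q + C·c_s + (c_q·C/N + N·c_s)`;
* `pmCost_lower_bound` — `(√c_q + √(C·c_s))² ≤ pmCost c_q c_s C N` for every `N > 0` (AM–GM on
  the two `N`-dependent terms);
* `pmOpt c_q c_s C = √(C·c_q/c_s)` and `pmCost_pmOpt` — the bound is ATTAINED there:
  `pmCost c_q c_s C N* = (√c_q + √(C·c_s))²`; `pmCost_pmOpt_le` — `N*` is a minimiser.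
So the best the pseudo-marginal route can do is pay `(√c_q + √(C c_s))²/ESS(∞)` per effectively
independent configuration, versus `c_q/ESS(∞)` for the exact-determinant marginal model with a free
determinant: the pseudofermion noise constant `C` enters as an additive `√(C c_s)` under the square.
(Integer `N_pf`: take the better of `⌊N*⌋`, `⌈N*⌉`; not formalised.)
-/

namespace Summit.Ventures.LatticeQCDFlow.Scaling

/-- Cost per effectively independent configuration of the pseudo-marginal / multi-draw route, in
units of `1/ESS(∞)`: `(c_q + N c_s)(1 + C/N)`. [folklore] -/
noncomputable def pmCost (cq cs C N : ℝ) : ℝ := (cq + N * cs) * (1 + C / N)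

/-- The claimed optimum `N* = √(C c_q / c_s)`. [folklore] -/
noncomputable def pmOpt (cq cs C : ℝ) : ℝ := Real.sqrt (C * cq / cs)

/-- Expansion: `pmCost = c_q + C c_s + (c_q C/N + N c_s)` (`N ≠ 0`). [folklore] -/
theorem pmCost_expand (cq cs C : ℝ) {N : ℝ} (hN : N ≠ 0) :
    pmCost cq cs C N = cq + C * cs + (cq * C / N + N * cs) := by
  unfold pmCost
  field_simp
  ring

/-- **Lower bound** (AM–GM): for `c_q, c_s, C ≥ 0` and every real `N > 0`,
`(√c_q + √(C c_s))² ≤ (c_q + N c_s)(1 + C/N)`. [folklore] -/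
theorem pmCost_lower_bound {cq cs C N : ℝ} (hq : 0 ≤ cq) (hs : 0 ≤ cs) (hC : 0 ≤ C)
    (hN : 0 < N) : (Real.sqrt cq + Real.sqrt (C * cs)) ^ 2 ≤ pmCost cq cs C N := by
  rw [pmCost_expand cq cs C hN.ne', add_sq, Real.sq_sqrt hq, Real.sq_sqrt (mul_nonneg hC hs)]
  -- AM–GM for the two `N`-dependent terms: `2 √(c_q C/N) √(N c_s) ≤ c_q C/N + N c_s`
  have hx : Real.sqrt (cq * C / N) ^ 2 = cq * C / N := Real.sq_sqrt (by positivity)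
  have hy : Real.sqrt (N * cs) ^ 2 = N * cs := Real.sq_sqrt (by positivity)
  have hxy : Real.sqrt (cq * C / N) * Real.sqrt (N * cs) = Real.sqrt cq * Real.sqrt (C * cs) := by
    rw [← Real.sqrt_mul (by positivity), ← Real.sqrt_mul hq]
    congr 1
    field_simp
  nlinarith [sq_nonneg (Real.sqrt (cq * C / N) - Real.sqrt (N * cs)), hx, hy, hxy]

/-- At `N* = √(C c_q/c_s)` the per-draw term equals `√(C c_q c_s)` (private helper). [folklore] -/
private theorem pmOpt_mul (cq : ℝ) {cs C : ℝ} (hs : 0 < cs) (hC : 0 ≤ C) (hq : 0 ≤ cq) :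
    pmOpt cq cs C * cs = Real.sqrt (C * cq * cs) := by
  unfold pmOpt
  calc Real.sqrt (C * cq / cs) * cs = Real.sqrt (C * cq / cs) * Real.sqrt (cs ^ 2) := by
        rw [Real.sqrt_sq hs.le]
    _ = Real.sqrt (C * cq / cs * cs ^ 2) := (Real.sqrt_mul (by positivity) _).symm
    _ = Real.sqrt (C * cq * cs) := by congr 1; field_simp

/-- At `N* = √(C c_q/c_s)` the per-proposal term also equals `√(C c_q c_s)` (private helper).
[folklore] -/
private theorem div_pmOpt {cq cs C : ℝ} (hq : 0 < cq) (hs : 0 < cs) (hC : 0 < C) :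
    cq * C / pmOpt cq cs C = Real.sqrt (C * cq * cs) := by
  unfold pmOpt
  have hpos : 0 < C * cq / cs := by positivity
  calc cq * C / Real.sqrt (C * cq / cs) = Real.sqrt ((cq * C) ^ 2) / Real.sqrt (C * cq / cs) := by
        rw [Real.sqrt_sq (by positivity)]
    _ = Real.sqrt ((cq * C) ^ 2 / (C * cq / cs)) := (Real.sqrt_div' _ hpos.le).symm
    _ = Real.sqrt (C * cq * cs) := by congr 1; field_simp

/-- **The bound is attained at `N* = √(C c_q/c_s)`**:
`pmCost c_q c_s C N* = c_q + C c_s + 2√(C c_q c_s) = (√c_q + √(C c_s))²` (all parameters positive).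
[folklore] -/
theorem pmCost_pmOpt {cq cs C : ℝ} (hq : 0 < cq) (hs : 0 < cs) (hC : 0 < C) :
    pmCost cq cs C (pmOpt cq cs C) = (Real.sqrt cq + Real.sqrt (C * cs)) ^ 2 := by
  have hNs : 0 < pmOpt cq cs C := Real.sqrt_pos.mpr (by positivity)
  rw [pmCost_expand cq cs C hNs.ne', div_pmOpt hq hs hC, pmOpt_mul cq hs hC.le hq.le, add_sq,
    Real.sq_sqrt hq.le, Real.sq_sqrt (by positivity), mul_assoc 2, ← Real.sqrt_mul hq.le,
    show cq * (C * cs) = C * cq * cs by ring]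
  ring

/-- **`N*` minimises the cost**: `pmCost c_q c_s C N* ≤ pmCost c_q c_s C N` for every real `N > 0`.
[folklore] -/
theorem pmCost_pmOpt_le {cq cs C N : ℝ} (hq : 0 < cq) (hs : 0 < cs) (hC : 0 < C) (hN : 0 < N) :
    pmCost cq cs C (pmOpt cq cs C) ≤ pmCost cq cs C N := by
  rw [pmCost_pmOpt hq hs hC]
  exact pmCost_lower_bound hq.le hs.le hC.le hN

/-- The optimum's defining property `N*² = C c_q / c_s` (the stationarity condition
`c_s = c_q C / N²`). [folklore] -/
theorem pmOpt_sq {cq cs C : ℝ} (hq : 0 ≤ cq) (hs : 0 < cs) (hC : 0 ≤ C) :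
    pmOpt cq cs C ^ 2 = C * cq / cs :=
  Real.sq_sqrt (by positivity)

end Summit.Ventures.LatticeQCDFlow.Scaling
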